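import Summits.ValiantsHypothesis.ValiantsHypothesis.Theses.UlrichPadded
import Literature.RingTheory.RegularLocalRing.GrothendieckSamuelHypersurfaceKernel

/-!
# Crux `PermHypersurfaceFactorial` (stmt-ValiantsHypothesis-5666), line `derivation-symbolic-square` —
stub 3 `stub_localFactorial`: regular in codimension `≤ 3` ⇒ locally factorial

For `S_n = ℂ[x_{n×n}]/(per_n)`: if the localisation of `S_n` at every prime of height `≤ 3` is a
regular local ring, then every local ring `(S_n)_M` (`M` prime) is factorial.  This is
Grothendieck's theorem on Samuel's conjecture (SGA 2 XI Cor. 3.14 with Thm. 3.13 (i)), hypersurface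
case, PROVED in the tree (`Grothendieck1968_samuelConjecture_hypersurface_holds`, consumer form
`Grothendieck1968_samuelConjecture_hypersurface.regular_codim_three`), applied to the regular local
ring `R = ℂ[x]_𝔪` (`𝔪` the preimage of `M`) and `f = per_n / 1 ∈ 𝔪 R`, and transported along
`(S_n)_M ≃+* R ⧸ (f)` (`nonempty_ringEquiv_localization_quotient_span_singleton`); the hypothesis
"regular in codimension `≤ 3`" travels from `S_n` to `(S_n)_M` (localisation of a localisation,
`IsLocalization.localizationLocalizationAtPrimeIsoLocalization`, heights preserved by
`IsLocalization.height_under`) and then across the isomorphism (`RingEquiv.height_comap`,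
`IsLocalization.ringEquivOfRingEquiv`).  Nothing here is specific to the permanent except the
types; the guard `3 ≤ n` is part of the registered signature and not used.
-/

noncomputable section

namespace Summit.ValiantsHypothesis.Theorems.PermHypersurfaceFactorial

open MvPolynomial IsLocalRing Literature.Computability.AlgebraicComplexity
open Literature.RingTheory.RegularLocalRing

/-- **Regularity in codimension `≤ c` is invariant under ring isomorphisms**: if every localisation
of `A` at a prime of height `≤ c` is regular and `e : A ≃+* B`, the same holds for `B` (a prime `Q'`
of `B` pulls back to a prime of the same height, and `A_{e⁻¹Q'} ≃+* B_{Q'}`). [folklore] -/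
theorem forall_height_le_isRegularLocalRing_of_ringEquiv {A B : Type*} [CommRing A] [CommRing B]
    (e : A ≃+* B) (c : ℕ∞)
    (h : ∀ (Q : Ideal A) [Q.IsPrime], Q.height ≤ c → IsRegularLocalRing (Localization.AtPrime Q)) :
    ∀ (Q' : Ideal B) [Q'.IsPrime], Q'.height ≤ c → IsRegularLocalRing (Localization.AtPrime Q') := by
  intro Q' _ hQ'
  have hht : (Q'.comap e).height = Q'.height := RingEquiv.height_comap e Q'
  haveI : IsRegularLocalRing (Localization.AtPrime (Q'.comap e)) := h (Q'.comap e) (hht ▸ hQ')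
  exact IsRegularLocalRing.of_ringEquiv <| IsLocalization.ringEquivOfRingEquiv
    (Localization.AtPrime (Q'.comap e)) (Localization.AtPrime Q') e (e.map_primeCompl_comap_eq Q')

/-- **Regularity in codimension `≤ c` passes to localisations at primes**: a localisation of `A_P`
at a prime `Q'` of height `≤ c` is `A_Q` for the prime `Q = Q' ∩ A ⊆ P` of the same height
(localisation of a localisation). [folklore] -/
theorem forall_height_le_isRegularLocalRing_localization_atPrime {A : Type*} [CommRing A]
    (c : ℕ∞)
    (h : ∀ (Q : Ideal A) [Q.IsPrime], Q.height ≤ c → IsRegularLocalRing (Localization.AtPrime Q))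
    (P : Ideal A) [P.IsPrime] :
    ∀ (Q' : Ideal (Localization.AtPrime P)) [Q'.IsPrime], Q'.height ≤ c →
      IsRegularLocalRing (Localization.AtPrime Q') := by
  intro Q' _ hQ'
  have hht : (Q'.comap (algebraMap A (Localization.AtPrime P))).height = Q'.height :=
    IsLocalization.height_under P.primeCompl Q'
  haveI : IsRegularLocalRing
      (Localization.AtPrime (Q'.comap (algebraMap A (Localization.AtPrime P)))) :=
    h _ (hht ▸ hQ')
  exact IsRegularLocalRing.of_ringEquiv
    (IsLocalization.localizationLocalizationAtPrimeIsoLocalization P.primeCompl Q').toRingEquiv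

/-- **Stub 3 of line `derivation-symbolic-square` (Grothendieck–Samuel, transported): regular in
codimension `≤ 3` ⇒ locally factorial.** For `n ≥ 3` (guard unused) and
`S_n = ℂ[x_{n×n}]/(per_n)`: if `(S_n)_Q` is a regular local ring for every prime `Q` of height
`≤ 3`, then for every prime `M` the local ring `(S_n)_M` is a factorial domain.  Proof:
`(S_n)_M ≃+* ℂ[x]_𝔪/(per_n)` with `ℂ[x]_𝔪` regular local and `per_n ∈ 𝔪`; the codimension-3
regularity hypothesis is transported to `ℂ[x]_𝔪/(per_n)` and fed to SGA 2 XI Cor. 3.14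
(hypersurface case, tree theorem `Grothendieck1968_samuelConjecture_hypersurface_holds` via
`.regular_codim_three`). [cite: Grothendieck1968SGA2, Exp. XI Cor. 3.14 and Thm. 3.13 (i)] -/
theorem stub_localFactorial :
    ∀ n : ℕ, 3 ≤ n →
      (∀ (Q : Ideal (MvPolynomial (Fin n × Fin n) ℂ ⧸ Ideal.span {perPoly (Fin n) ℂ})) [Q.IsPrime],
          Q.height ≤ 3 → IsRegularLocalRing (Localization.AtPrime Q)) →
        ∀ (M : Ideal (MvPolynomial (Fin n × Fin n) ℂ ⧸ Ideal.span {perPoly (Fin n) ℂ})) [M.IsPrime],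
          ∃ _ : IsDomain (Localization.AtPrime M),
            UniqueFactorizationMonoid (Localization.AtPrime M) := by
  intro n _ hreg M hM
  -- the preimage `𝔪` of `M` in `ℂ[x]` and the regular local ring `ℂ[x]_𝔪`
  let 𝔪 : Ideal (MvPolynomial (Fin n × Fin n) ℂ) :=
    M.comap (Ideal.Quotient.mk (Ideal.span {perPoly (Fin n) ℂ}))
  haveI : 𝔪.IsPrime := Ideal.comap_isPrime _ M
  haveI : IsRegularLocalRing (Localization.AtPrime 𝔪) := inferInstance
  have hfm : perPoly (Fin n) ℂ ∈ 𝔪 := by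
    change Ideal.Quotient.mk (Ideal.span {perPoly (Fin n) ℂ}) (perPoly (Fin n) ℂ) ∈ M
    rw [Ideal.Quotient.eq_zero_iff_mem.mpr (Ideal.mem_span_singleton_self _)]
    exact M.zero_mem
  have hf' : algebraMap (MvPolynomial (Fin n × Fin n) ℂ) (Localization.AtPrime 𝔪) (perPoly (Fin n) ℂ)
      ∈ maximalIdeal (Localization.AtPrime 𝔪) := by
    rw [← Localization.AtPrime.map_eq_maximalIdeal]
    exact Ideal.mem_map_of_mem _ hfm
  -- `(S_n)_M ≃+* ℂ[x]_𝔪 / (per_n)`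
  obtain ⟨e⟩ := nonempty_ringEquiv_localization_quotient_span_singleton (perPoly (Fin n) ℂ) M
  refine exists_isDomain_ufm_of_ringEquiv e.symm ?_
  refine Grothendieck1968_samuelConjecture_hypersurface.regular_codim_three
    Grothendieck1968_samuelConjecture_hypersurface_holds (Localization.AtPrime 𝔪) _ hf' ?_
  -- regular in codimension `≤ 3`: from `S_n` to `(S_n)_M` to `ℂ[x]_𝔪/(per_n)`
  exact forall_height_le_isRegularLocalRing_of_ringEquiv e 3
    (forall_height_le_isRegularLocalRing_localization_atPrime 3 hreg M)

end Summit.ValiantsHypothesis.Theorems.PermHypersurfaceFactorial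

end
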